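import Mathlib.Algebra.Group.Fin.Basic
import Literature.InformationTheory.QuantumCodes.StabilizerDistance
import Literature.InformationTheory.QuantumCodes.GF4LinearCodes
import HarnessLib

/-!
# Cyclic additive and linear quantum codes: the self-orthogonality criteria (CRSS Theorems 13 and 14 (c)) — proved

Source: Calderbank–Rains–Shor–Sloane, *Quantum error correction via codes over GF(4)*, IEEE Trans. IT 44
(1998) 1369 = arXiv:quant-ph/9608006v5 [CalderbankEtAl1998], §5 "Cyclic and related codes" (printed
pp. 18–21, held PDF pages p0019–p0022):

> «An `(n, 2^k)` additive code `C` is constacyclic if there is a constant `κ` … such that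
> `(u₀, u₁, …, u_{n−1}) ∈ C` implies `(κu_{n−1}, u₀, u₁, …, u_{n−2}) ∈ C`. If `κ = 1` the code is cyclic.»
> (p. 18–19)
>
> **Theorem 13.** «A linear cyclic or constacyclic code with generator polynomial `g(x)` is self-orthogonal
> if and only if `g(x)g†(x) ≡ 0 (mod xⁿ − κ)`, where if `g(x) = Σ_{j=0}^{n−1} g_j x^j`,
> `g†(x) = κ ḡ₀ + Σ_{j=1}^{n−1} ḡ_{n−j} x^j`. (10) We omit the elementary proof (cf. [15]). Note that
> `g†(x) ≡ ḡ(x⁻¹) (mod xⁿ − κ)`.» (p. 19)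
>
> **Theorem 14.** «(a) Any `(n, 2^k)` additive cyclic code `C` has two generators, and can be represented as
> `⟨ωp(x) + q(x), r(x)⟩`, where `p(x), q(x), r(x)` are binary polynomials … (c) `C` is self-orthogonal if
> and only if `p(x)r(x^{n−1}) ≡ p(x^{n−1})r(x) ≡ 0 (mod xⁿ − 1)`, `p(x)q(x^{n−1}) ≡ p(x^{n−1})q(x)
> (mod xⁿ − 1)`.» Proof of (c) (p. 21): «One readily verifies that the inner product of the vectors
> corresponding to `ωf(x) + g(x)` and `ωh(x) + i(x)` is given by the constant coefficient of
> `f(x)i(x^{n−1}) + g(x)h(x^{n−1}) (mod xⁿ − 1)`. But then the inner product of the vectors corresponding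
> to `ωf(x) + g(x)` and `x^m(ωh(x) + i(x))` is given by the coefficient of `x^m` in
> `f(x)i(x^{n−1}) + g(x)h(x^{n−1})`. The result follows immediately.»

## Dictionary (binary symplectic language of `SymplecticCodes.lean` / `GF4LinearCodes.lean`)

* Polynomials of `𝔽₂[x]/(xⁿ − 1)` are their coefficient vectors `Fin n → 𝔽₂` (indices read in `ℤ/n`,
  `NeZero n`): `monMul m u = x^m · u` (`(x^m u)_j = u_{j−m}`), `cycMul a b = a(x)b(x) mod xⁿ − 1`
  (`(ab)_k = Σ_j a_{k−j} b_j`), `cycRev a = a(x^{n−1}) = a(x⁻¹) mod xⁿ − 1` (`a_{−j}`), `coeff m` = the value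
  at `m`.
* A vector `u ∈ GF(4)ⁿ` is `φ(a|b) = ωa + ω̄b`; the printed `ωp(x) + q(x)` with binary `p, q` is
  `ω(p + q) + ω̄q`, i.e. `gf4Pair p q = (p + q | q)`; a binary `r(x)` is `(r | r)`; `ω·` is `omegaMul`.
* The cyclic shift `x·u` acts on both halves: `monMulSymp m`. `IsCyclicCode S̄` = closed under `x·`.
  The additive cyclic code `⟨ωp + q, r⟩` is the span of all `x^m(ωp + q)` and `x^m r` (`addCyclicCode`); the
  linear cyclic code with generator polynomial `g` is the span of all `x^m g` and `x^m ωg` (`linCyclicCode`;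
  as an additive code `⟨g⟩ = GF(4)[x]·g` is generated by `g` and `ωg`).
* The product in `GF(4)[x]/(xⁿ − 1)` in the `φ`-coordinates: `(ωa + ω̄b)(ωc + ω̄d) = ω̄ac + (ad + bc) + ωbd
  = ω(ad + bc + bd) + ω̄(ac + ad + bc)` (`ω² = ω̄`, `ω̄² = ω`, `ωω̄ = 1 = ω + ω̄`): `gf4CycMul`; conjugation
  swaps the halves, so `g† = ḡ(x⁻¹) = (b̃ | ã)` for `g = (a|b)`: `gf4Dagger`.

## What is PROVED

* `sympInner_monMulSymp` — shift calculus: `(x^s v, x^t w) = (v₁w̃₂ + v₂w̃₁)(t − s)`;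
* **`CRSS1998_theorem14c_key`** — the printed key sentence: `(ωf + g, x^m(ωh + i))` = the coefficient of `x^m`
  in `f(x)i(x^{n−1}) + g(x)h(x^{n−1})`;
* `isCyclicCode_addCyclicCode`, `isCyclicCode_linCyclicCode`, `isGF4Linear_linCyclicCode`;
* **`CRSS1998_theorem14c`** — `⟨ωp + q, r⟩` is self-orthogonal iff `p(x)r(x^{n−1}) ≡ 0`, `p(x^{n−1})r(x) ≡ 0`
  and `p(x)q(x^{n−1}) ≡ p(x^{n−1})q(x)` (mod `xⁿ − 1`);
* **`CRSS1998_theorem13`** (the cyclic case `κ = 1`) — the linear cyclic code with generator polynomial `g`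
  is self-orthogonal iff `g(x)g†(x) ≡ 0 (mod xⁿ − 1)`.

NOT here: Theorem 14 (a), (b) (every additive cyclic code HAS such a two-generator representation with
`p, r ∣ xⁿ − 1`, unique `p, r`; this needs the principal-ideal structure of binary cyclic codes), the
constacyclic cases `κ = ω, ω̄` of Theorem 13 (TODO(general form): the twisted shift multiplies the wrapped
coordinate by `κ`), Theorem 15 (conjucyclic codes) and Table I. No named facts.
-/

namespace Literature.InformationTheory.QuantumCodes

open Matrix Finset

variable {n : ℕ} [NeZero n]

/-! ### Binary polynomials modulo `xⁿ − 1` as coefficient vectors -/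

/-- **Multiplication by `x^m`** in `𝔽₂[x]/(xⁿ − 1)` on coefficient vectors: `(x^m · u)_j = u_{j−m}` — the
`m`-fold cyclic shift `(u₀, …, u_{n−1}) ↦ (u_{n−1}, u₀, …, u_{n−2})`.
[cite: CalderbankEtAl1998, §5 (printed pp. 18–19: definition of a cyclic code; "vectors are represented by polynomials in the natural way")] -/
def monMul (m : Fin n) (u : Fin n → ZMod 2) : Fin n → ZMod 2 := fun j => u (j - m)

/-- **Product modulo `xⁿ − 1`**: `(ab)_k = Σ_j a_{k−j} b_j`. [cite: CalderbankEtAl1998, §5 (printed p. 19: "the ring of polynomials modulo xⁿ − κ")] -/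
def cycMul (a b : Fin n → ZMod 2) : Fin n → ZMod 2 := fun k => ∑ j, a (k - j) * b j

/-- **`a(x^{n−1}) = a(x⁻¹) (mod xⁿ − 1)`**: coefficient `j ↦ a_{−j}`.
[cite: CalderbankEtAl1998, §5 Thm. 13 (printed p. 19: "g†(x) ≡ ḡ(x⁻¹) (mod xⁿ − κ)") and Thm. 14 (c) ("r(x^{n−1})")] -/
def cycRev (a : Fin n → ZMod 2) : Fin n → ZMod 2 := fun j => a (-j)

omit [NeZero n] in
/-- Unfolding. [cite: CalderbankEtAl1998, §5 (printed p. 19)] -/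
theorem cycMul_apply (a b : Fin n → ZMod 2) (k : Fin n) : cycMul a b k = ∑ j, a (k - j) * b j := rfl

/-- `x⁰ · u = u`. [cite: CalderbankEtAl1998, §5 (printed p. 19)] -/
@[simp] theorem monMul_zero (u : Fin n → ZMod 2) : monMul 0 u = u := by
  funext j; simp [monMul]

/-- `x^s (x^t u) = x^{s+t} u`. [cite: CalderbankEtAl1998, §5 (printed p. 19)] -/
theorem monMul_monMul (s t : Fin n) (u : Fin n → ZMod 2) : monMul s (monMul t u) = monMul (s + t) u := by
  funext j; simp only [monMul]; congr 1; abel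

omit [NeZero n] in
/-- `x^m · 0 = 0`. [cite: CalderbankEtAl1998, §5 (printed p. 19)] -/
@[simp] theorem monMul_zero_right (m : Fin n) : monMul m (0 : Fin n → ZMod 2) = 0 := rfl

omit [NeZero n] in
/-- `x^m (u + u') = x^m u + x^m u'`. [cite: CalderbankEtAl1998, §5 (printed p. 19)] -/
theorem monMul_add (m : Fin n) (u u' : Fin n → ZMod 2) : monMul m (u + u') = monMul m u + monMul m u' := rfl

/-- The product modulo `xⁿ − 1` is commutative. [cite: CalderbankEtAl1998, §5 (printed p. 19)] -/
theorem cycMul_comm (a b : Fin n → ZMod 2) : cycMul a b = cycMul b a := by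
  funext k
  simp only [cycMul_apply]
  refine Fintype.sum_equiv (Equiv.subLeft k) _ _ fun j => ?_
  simp only [Equiv.subLeft_apply, sub_sub_cancel, mul_comm]

omit [NeZero n] in
/-- Distributivity on the left. [cite: CalderbankEtAl1998, §5 (printed p. 19)] -/
theorem cycMul_add_left (a a' b : Fin n → ZMod 2) : cycMul (a + a') b = cycMul a b + cycMul a' b := by
  funext k; simp [cycMul_apply, add_mul, Finset.sum_add_distrib]

omit [NeZero n] in
/-- Distributivity on the right. [cite: CalderbankEtAl1998, §5 (printed p. 19)] -/
theorem cycMul_add_right (a b b' : Fin n → ZMod 2) : cycMul a (b + b') = cycMul a b + cycMul a b' := by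
  funext k; simp [cycMul_apply, mul_add, Finset.sum_add_distrib]

omit [NeZero n] in
/-- `0 · b = 0`. [cite: CalderbankEtAl1998, §5 (printed p. 19)] -/
@[simp] theorem cycMul_zero_left (b : Fin n → ZMod 2) : cycMul 0 b = 0 := by
  funext k; simp [cycMul_apply]

omit [NeZero n] in
/-- `a · 0 = 0`. [cite: CalderbankEtAl1998, §5 (printed p. 19)] -/
@[simp] theorem cycMul_zero_right (a : Fin n → ZMod 2) : cycMul a 0 = 0 := by
  funext k; simp [cycMul_apply]

omit [NeZero n] in
/-- `(a + b)(x⁻¹) = a(x⁻¹) + b(x⁻¹)`. [cite: CalderbankEtAl1998, §5 (printed p. 19)] -/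
theorem cycRev_add (a b : Fin n → ZMod 2) : cycRev (a + b) = cycRev a + cycRev b := rfl

omit [NeZero n] in
/-- `0(x⁻¹) = 0`. [cite: CalderbankEtAl1998, §5 (printed p. 19)] -/
@[simp] theorem cycRev_zero : cycRev (0 : Fin n → ZMod 2) = 0 := rfl

omit [NeZero n] in
/-- In characteristic two `u + u = 0` for coefficient vectors. [folklore] -/
private theorem vec_add_self (u : Fin n → ZMod 2) : u + u = 0 :=
  funext fun j => (by decide : ∀ x : ZMod 2, x + x = 0) (u j)

/-- **`a · (x^m c) = [x^m] a(x)c(x⁻¹)`**: the scalar product of `a` with the `m`-fold shift of `c` is the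
coefficient of `x^m` in `a(x)c(x^{n−1}) (mod xⁿ − 1)`.
[cite: CalderbankEtAl1998, §5 proof of Thm. 14 (c) (printed p. 21)] -/
theorem dotProduct_monMul (a c : Fin n → ZMod 2) (m : Fin n) :
    a ⬝ᵥ monMul m c = cycMul a (cycRev c) m := by
  simp only [dotProduct, monMul, cycMul_apply, cycRev]
  symm
  refine Fintype.sum_equiv (Equiv.subLeft m) _ _ fun j => ?_
  simp only [Equiv.subLeft_apply]
  congr 2
  abel

/-- Shift invariance: `(x^s a) · (x^t c) = a · (x^{t−s} c)`. [cite: CalderbankEtAl1998, §5 proof of Thm. 14 (c) (printed p. 21)] -/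
theorem monMul_dotProduct_monMul (s t : Fin n) (a c : Fin n → ZMod 2) :
    monMul s a ⬝ᵥ monMul t c = a ⬝ᵥ monMul (t - s) c := by
  simp only [dotProduct, monMul]
  refine Fintype.sum_equiv (Equiv.subRight s) _ _ fun j => ?_
  simp only [Equiv.subRight_apply]
  congr 2
  abel

/-! ### The cyclic shift on `Ē` and cyclic additive codes -/

/-- **Multiplication by `x^m` on `GF(4)ⁿ ≅ Ē`**: shift both halves. [cite: CalderbankEtAl1998, §5 (printed pp. 18–19: "(u₀, …, u_{n−1}) ∈ C implies (u_{n−1}, u₀, …, u_{n−2}) ∈ C")] -/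
def monMulSymp (m : Fin n) : SympVec n →ₗ[ZMod 2] SympVec n where
  toFun v := (monMul m v.1, monMul m v.2)
  map_add' _ _ := rfl
  map_smul' _ _ := rfl

omit [NeZero n] in
/-- Unfolding. [cite: CalderbankEtAl1998, §5 (printed pp. 18–19)] -/
@[simp] theorem monMulSymp_apply (m : Fin n) (v : SympVec n) :
    monMulSymp m v = (monMul m v.1, monMul m v.2) := rfl

/-- `x^s (x^t v) = x^{s+t} v` on `Ē`. [cite: CalderbankEtAl1998, §5 (printed pp. 18–19)] -/
theorem monMulSymp_monMulSymp (s t : Fin n) (v : SympVec n) :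
    monMulSymp s (monMulSymp t v) = monMulSymp (s + t) v := by
  simp [monMul_monMul]

/-- **A cyclic additive code**: `u ∈ C ⇒ x·u ∈ C` (closed under the cyclic shift).
[cite: CalderbankEtAl1998, §5 (printed pp. 18–19: "If κ = 1 the code is cyclic")] -/
def IsCyclicCode (S : Submodule (ZMod 2) (SympVec n)) : Prop := ∀ v ∈ S, monMulSymp 1 v ∈ S

open Fin.NatCast in
/-- A cyclic code is closed under every power of the shift. [cite: CalderbankEtAl1998, §5 (printed pp. 18–19)] -/
theorem IsCyclicCode.monMulSymp_mem {S : Submodule (ZMod 2) (SympVec n)} (hS : IsCyclicCode S) (m : Fin n)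
    {v : SympVec n} (hv : v ∈ S) : monMulSymp m v ∈ S := by
  -- `x^m = x · x ⋯ x` (`m` times)
  have key : ∀ k : ℕ, monMulSymp ((k : Fin n)) v ∈ S := by
    intro k
    induction k with
    | zero =>
      rw [Nat.cast_zero, show monMulSymp (0 : Fin n) v = v by simp]
      exact hv
    | succ k ih =>
      have := hS _ ih
      rw [monMulSymp_monMulSymp] at this
      rwa [Nat.cast_succ, add_comm]
  have := key m.val
  rwa [Fin.cast_val_eq_self] at this

/-- **Shift calculus for the symplectic (trace) inner product**:
`(x^s v, x^t w) = (v₁ w₂(x⁻¹) + v₂ w₁(x⁻¹))` at the exponent `t − s`.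
[cite: CalderbankEtAl1998, §5 proof of Thm. 14 (c) (printed p. 21)] -/
theorem sympInner_monMulSymp (s t : Fin n) (v w : SympVec n) :
    sympInner (monMulSymp s v) (monMulSymp t w) =
      (cycMul v.1 (cycRev w.2) + cycMul v.2 (cycRev w.1)) (t - s) := by
  simp only [sympInner, monMulSymp_apply, Pi.add_apply]
  rw [monMul_dotProduct_monMul, dotProduct_monMul, dotProduct_comm, monMul_dotProduct_monMul,
    dotProduct_monMul]

/-- **The vector `ωf(x) + g(x)`** for binary `f, g`: `ωf + g = ω(f + g) + ω̄g = φ(f + g | g)`.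
[cite: CalderbankEtAl1998, §5 Thm. 14 (a) (printed p. 20: "⟨ωp(x) + q(x), r(x)⟩, where p(x), q(x), r(x) are binary polynomials")] -/
def gf4Pair (f g : Fin n → ZMod 2) : SympVec n := (f + g, g)

omit [NeZero n] in
/-- A binary polynomial `r(x)` is the vector `φ(r | r)` (`ω + ω̄ = 1`). [cite: CalderbankEtAl1998, §5 Thm. 14 (a) (printed p. 20)] -/
theorem gf4Pair_zero_left (r : Fin n → ZMod 2) : gf4Pair 0 r = (r, r) := by
  simp [gf4Pair]

/-- **The printed key computation (proof of Theorem 14 (c))**: «the inner product of the vectors corresponding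
to `ωf(x) + g(x)` and `x^m(ωh(x) + i(x))` is given by the coefficient of `x^m` in
`f(x)i(x^{n−1}) + g(x)h(x^{n−1})`» (for `m = 0`: «the constant coefficient»).
[cite: CalderbankEtAl1998, §5 proof of Thm. 14 (c) (printed p. 21)] -/
theorem CRSS1998_theorem14c_key (f g h i : Fin n → ZMod 2) (m : Fin n) :
    sympInner (gf4Pair f g) (monMulSymp m (gf4Pair h i)) =
      (cycMul f (cycRev i) + cycMul g (cycRev h)) m := by
  have := sympInner_monMulSymp 0 m (gf4Pair f g) (gf4Pair h i)
  rw [show monMulSymp 0 (gf4Pair f g) = gf4Pair f g by simp [gf4Pair], sub_zero] at this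
  rw [this]
  simp only [gf4Pair, cycRev_add, cycMul_add_left, cycMul_add_right, Pi.add_apply]
  -- `f ĩ + g ĩ + (g h̃ + g ĩ) = f ĩ + g h̃`
  have h2 : ∀ x : ZMod 2, x + x = 0 := by decide
  linear_combination (h2 (cycMul g (cycRev i) m))

/-! ### Theorem 14 (c): the additive cyclic code `⟨ωp + q, r⟩` -/

/-- The generators of the additive cyclic code `⟨ωp(x) + q(x), r(x)⟩`: all shifts `x^m(ωp + q)` and `x^m r`.
[cite: CalderbankEtAl1998, §5 Thm. 14 (a) (printed p. 20)] -/
def addCycGen (p q r : Fin n → ZMod 2) : Fin n ⊕ Fin n → SympVec n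
  | Sum.inl m => monMulSymp m (gf4Pair p q)
  | Sum.inr m => monMulSymp m (gf4Pair 0 r)

/-- **The additive cyclic code `⟨ωp(x) + q(x), r(x)⟩`** (binary `p, q, r`): the `𝔽₂`-span of all cyclic shifts
of `ωp + q` and of `r`. [cite: CalderbankEtAl1998, §5 Thm. 14 (a) (printed p. 20)] -/
def addCyclicCode (p q r : Fin n → ZMod 2) : Submodule (ZMod 2) (SympVec n) :=
  Submodule.span (ZMod 2) (Set.range (addCycGen p q r))

omit [NeZero n] in
/-- The first family of generators. [cite: CalderbankEtAl1998, §5 Thm. 14 (a) (printed p. 20)] -/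
@[simp] theorem addCycGen_inl (p q r : Fin n → ZMod 2) (m : Fin n) :
    addCycGen p q r (Sum.inl m) = monMulSymp m (gf4Pair p q) := rfl

omit [NeZero n] in
/-- The second family of generators. [cite: CalderbankEtAl1998, §5 Thm. 14 (a) (printed p. 20)] -/
@[simp] theorem addCycGen_inr (p q r : Fin n → ZMod 2) (m : Fin n) :
    addCycGen p q r (Sum.inr m) = monMulSymp m (gf4Pair 0 r) := rfl

/-- `⟨ωp + q, r⟩` is a cyclic code. [cite: CalderbankEtAl1998, §5 Thm. 14 (a) (printed p. 20)] -/
theorem isCyclicCode_addCyclicCode (p q r : Fin n → ZMod 2) : IsCyclicCode (addCyclicCode p q r) := by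
  intro v hv
  have hle : addCyclicCode p q r ≤ (addCyclicCode p q r).comap (monMulSymp 1) := by
    rw [addCyclicCode, Submodule.span_le]
    rintro _ ⟨x, rfl⟩
    rw [SetLike.mem_coe, Submodule.mem_comap]
    rcases x with m | m
    · rw [addCycGen_inl, monMulSymp_monMulSymp]
      exact Submodule.subset_span ⟨Sum.inl (1 + m), rfl⟩
    · rw [addCycGen_inr, monMulSymp_monMulSymp]
      exact Submodule.subset_span ⟨Sum.inr (1 + m), rfl⟩
  exact hle hv

/-- Inner products of two generators of `⟨ωp + q, r⟩`, by type (shift difference `t − s`).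
[cite: CalderbankEtAl1998, §5 proof of Thm. 14 (c) (printed p. 21)] -/
theorem sympInner_addCycGen (p q r : Fin n → ZMod 2) (x y : Fin n ⊕ Fin n) :
    sympInner (addCycGen p q r x) (addCycGen p q r y) =
      match x, y with
      | Sum.inl s, Sum.inl t => (cycMul p (cycRev q) + cycMul q (cycRev p)) (t - s)
      | Sum.inl s, Sum.inr t => cycMul p (cycRev r) (t - s)
      | Sum.inr s, Sum.inl t => cycMul r (cycRev p) (t - s)
      | Sum.inr _, Sum.inr _ => 0 := by
  have h2 : ∀ x : ZMod 2, x + x = 0 := by decide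
  rcases x with s | s <;> rcases y with t | t <;>
    simp only [addCycGen_inl, addCycGen_inr, sympInner_monMulSymp, gf4Pair, zero_add, cycRev_add,
      cycMul_add_left, cycMul_add_right, Pi.add_apply]
  · linear_combination (h2 (cycMul q (cycRev q) (t - s)))
  · linear_combination (h2 (cycMul q (cycRev r) (t - s)))
  · linear_combination (h2 (cycMul r (cycRev q) (t - s)))
  · exact h2 _

/-- **CRSS Theorem 14 (c)** (PROVED): the additive cyclic code `⟨ωp(x) + q(x), r(x)⟩` is self-orthogonal iff
`p(x)r(x^{n−1}) ≡ 0`, `p(x^{n−1})r(x) ≡ 0` and `p(x)q(x^{n−1}) ≡ p(x^{n−1})q(x)` modulo `xⁿ − 1`.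
[cite: CalderbankEtAl1998, §5 Thm. 14 (c) (printed pp. 20–21)] -/
theorem CRSS1998_theorem14c (p q r : Fin n → ZMod 2) :
    IsSelfOrthogonal (addCyclicCode p q r) ↔
      (cycMul p (cycRev r) = 0 ∧ cycMul (cycRev p) r = 0) ∧ cycMul p (cycRev q) = cycMul (cycRev p) q := by
  rw [addCyclicCode, isSelfOrthogonal_span_range_iff]
  have hvec : ∀ {x y : Fin n → ZMod 2}, x + y = 0 ↔ x = y := fun {x y} =>
    ⟨fun h => funext fun j => (by decide : ∀ u v : ZMod 2, u + v = 0 → u = v) _ _ (congrFun h j),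
     fun h => h ▸ vec_add_self _⟩
  constructor
  · intro h
    refine ⟨⟨funext fun m => ?_, funext fun m => ?_⟩, ?_⟩
    · have := h (Sum.inl 0) (Sum.inr m)
      rw [sympInner_addCycGen] at this
      simpa using this
    · have := h (Sum.inr 0) (Sum.inl m)
      rw [sympInner_addCycGen] at this
      rw [cycMul_comm]
      simpa using this
    · rw [← hvec]
      funext m
      have := h (Sum.inl 0) (Sum.inl m)
      rw [sympInner_addCycGen] at this
      rw [cycMul_comm (cycRev p) q]
      simpa using this
  · rintro ⟨⟨hpr, hrp⟩, hpq⟩ x y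
    rw [sympInner_addCycGen]
    rcases x with s | s <;> rcases y with t | t
    · show (cycMul p (cycRev q) + cycMul q (cycRev p)) (t - s) = 0
      rw [hpq, cycMul_comm q, vec_add_self, Pi.zero_apply]
    · show cycMul p (cycRev r) (t - s) = 0
      rw [hpr, Pi.zero_apply]
    · show cycMul r (cycRev p) (t - s) = 0
      rw [cycMul_comm, hrp, Pi.zero_apply]
    · rfl

/-! ### Theorem 13 (cyclic case `κ = 1`): linear cyclic codes with generator polynomial `g(x)` -/

/-- **The product in `GF(4)[x]/(xⁿ − 1)`** in the coordinates `φ(a|b) = ωa + ω̄b` (coefficientwise):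
`(ωa + ω̄b)(ωc + ω̄d) = ω̄·ac + (ad + bc) + ω·bd = ω(ad + bc + bd) + ω̄(ac + ad + bc)` (`ω² = ω̄`, `ω̄² = ω`,
`ωω̄ = 1 = ω + ω̄`). [cite: CalderbankEtAl1998, §3 (printed p. 9: "ω̄ = ω² = 1 + ω") and §5 Thm. 13 (printed p. 19)] -/
def gf4CycMul (v w : SympVec n) : SympVec n :=
  (cycMul v.1 w.2 + cycMul v.2 w.1 + cycMul v.2 w.2, cycMul v.1 w.1 + cycMul v.1 w.2 + cycMul v.2 w.1)

/-- **`g†(x) = ḡ(x⁻¹) (mod xⁿ − 1)`**: conjugation `ω ↔ ω̄` swaps the two halves (`\overline{ωa + ω̄b} = ω̄a + ωb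
= φ(b|a)`) and `x ↦ x⁻¹` reverses the coefficients. [cite: CalderbankEtAl1998, §5 Thm. 13 eq. (10) (printed p. 19: "g†(x) ≡ ḡ(x⁻¹) (mod xⁿ − κ)")] -/
def gf4Dagger (g : SympVec n) : SympVec n := (cycRev g.2, cycRev g.1)

/-- Sanity check of the dictionary (constants, `n = 1`): `ω·ω = ω̄`, `ω̄·ω̄ = ω`, `ω·ω̄ = 1`
(`ω = (1|0)`, `ω̄ = (0|1)`, `1 = (1|1)`). [cite: CalderbankEtAl1998, §3 (printed p. 9)] -/
theorem gf4CycMul_constants :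
    gf4CycMul (n := 1) (1, 0) (1, 0) = (0, 1) ∧ gf4CycMul (n := 1) (0, 1) (0, 1) = (1, 0) ∧
      gf4CycMul (n := 1) (1, 0) (0, 1) = (1, 1) := by
  refine ⟨?_, ?_, ?_⟩ <;> decide

/-- The generators, as an additive code, of the linear cyclic code `⟨g(x)⟩ = GF(4)[x]·g(x)`: all `x^m g` and
`x^m (ωg)`. [cite: CalderbankEtAl1998, §5 (printed p. 19: "the code consists simply of all multiples of a single generator polynomial g(x)")] -/
def linCycGen (g : SympVec n) : Fin n ⊕ Fin n → SympVec n
  | Sum.inl m => monMulSymp m g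
  | Sum.inr m => monMulSymp m (omegaMul n g)

/-- **The linear cyclic code with generator polynomial `g(x)`** (`κ = 1`), as a subspace of `Ē`: the
`𝔽₂`-span of the `x^m g` and `x^m ωg`. [cite: CalderbankEtAl1998, §5 (printed p. 19)] -/
def linCyclicCode (g : SympVec n) : Submodule (ZMod 2) (SympVec n) :=
  Submodule.span (ZMod 2) (Set.range (linCycGen g))

omit [NeZero n] in
/-- The first family of generators. [cite: CalderbankEtAl1998, §5 (printed p. 19)] -/
@[simp] theorem linCycGen_inl (g : SympVec n) (m : Fin n) : linCycGen g (Sum.inl m) = monMulSymp m g := rfl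

omit [NeZero n] in
/-- The second family of generators. [cite: CalderbankEtAl1998, §5 (printed p. 19)] -/
@[simp] theorem linCycGen_inr (g : SympVec n) (m : Fin n) :
    linCycGen g (Sum.inr m) = monMulSymp m (omegaMul n g) := rfl

omit [NeZero n] in
/-- `ω` commutes with the shift. [cite: CalderbankEtAl1998, §5 (printed p. 19)] -/
theorem omegaMul_monMulSymp (m : Fin n) (v : SympVec n) :
    omegaMul n (monMulSymp m v) = monMulSymp m (omegaMul n v) := rfl

omit [NeZero n] in
/-- `ω² v = v + ωv` (`ω² = ω + 1`). [cite: CalderbankEtAl1998, §3 (printed p. 9: "ω̄ = ω² = 1 + ω")] -/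
theorem omegaMul_omegaMul (v : SympVec n) : omegaMul n (omegaMul n v) = v + omegaMul n v := by
  refine Prod.ext ?_ ?_
  · simp only [omegaMul_apply, Prod.fst_add]
  · simp only [omegaMul_apply, Prod.snd_add]

/-- `⟨g⟩` is a cyclic code. [cite: CalderbankEtAl1998, §5 (printed p. 19)] -/
theorem isCyclicCode_linCyclicCode (g : SympVec n) : IsCyclicCode (linCyclicCode g) := by
  intro v hv
  have hle : linCyclicCode g ≤ (linCyclicCode g).comap (monMulSymp 1) := by
    rw [linCyclicCode, Submodule.span_le]
    rintro _ ⟨x, rfl⟩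
    rw [SetLike.mem_coe, Submodule.mem_comap]
    rcases x with m | m
    · rw [linCycGen_inl, monMulSymp_monMulSymp]
      exact Submodule.subset_span ⟨Sum.inl (1 + m), rfl⟩
    · rw [linCycGen_inr, monMulSymp_monMulSymp]
      exact Submodule.subset_span ⟨Sum.inr (1 + m), rfl⟩
  exact hle hv

omit [NeZero n] in
/-- `⟨g⟩` is linear (closed under multiplication by `ω`). [cite: CalderbankEtAl1998, §5 (printed p. 19: "We begin with linear codes")] -/
theorem isGF4Linear_linCyclicCode (g : SympVec n) : IsGF4Linear (linCyclicCode g) := by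
  intro v hv
  have hle : linCyclicCode g ≤ (linCyclicCode g).comap (omegaMul n : SympVec n →ₗ[ZMod 2] SympVec n) := by
    rw [linCyclicCode, Submodule.span_le]
    rintro _ ⟨x, rfl⟩
    rw [SetLike.mem_coe, Submodule.mem_comap, LinearEquiv.coe_coe]
    rcases x with m | m
    · rw [linCycGen_inl, omegaMul_monMulSymp]
      exact Submodule.subset_span ⟨Sum.inr m, rfl⟩
    · rw [linCycGen_inr, omegaMul_monMulSymp, omegaMul_omegaMul, map_add]
      exact Submodule.add_mem _ (Submodule.subset_span ⟨Sum.inl m, rfl⟩)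
        (Submodule.subset_span ⟨Sum.inr m, rfl⟩)
  exact hle hv

/-- Inner products of two generators of `⟨g⟩`, `g = (a|b)`, by type (shift difference `t − s`): the two
components of `g g†` and their sum. [cite: CalderbankEtAl1998, §5 Thm. 13 (printed p. 19)] -/
theorem sympInner_linCycGen (g : SympVec n) (x y : Fin n ⊕ Fin n) :
    sympInner (linCycGen g x) (linCycGen g y) =
      match x, y with
      | Sum.inl s, Sum.inl t => (cycMul g.1 (cycRev g.2) + cycMul g.2 (cycRev g.1)) (t - s)
      | Sum.inl s, Sum.inr t => (gf4CycMul g (gf4Dagger g)).2 (t - s)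
      | Sum.inr s, Sum.inl t => (gf4CycMul g (gf4Dagger g)).1 (t - s)
      | Sum.inr s, Sum.inr t => (cycMul g.1 (cycRev g.2) + cycMul g.2 (cycRev g.1)) (t - s) := by
  have h2 : ∀ x : ZMod 2, x + x = 0 := by decide
  rcases x with s | s <;> rcases y with t | t <;>
    simp only [linCycGen_inl, linCycGen_inr, sympInner_monMulSymp, omegaMul_apply, gf4CycMul, gf4Dagger,
      cycRev_add, cycMul_add_left, cycMul_add_right, Pi.add_apply]
  · ring
  · ring
  · linear_combination (h2 (cycMul g.2 (cycRev g.2) (t - s)))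

/-- **CRSS Theorem 13, cyclic case `κ = 1`** (PROVED): the linear cyclic code with generator polynomial `g(x)`
is self-orthogonal iff `g(x)g†(x) ≡ 0 (mod xⁿ − 1)` — computed coefficientwise in the `φ`-coordinates
(`gf4CycMul`, `gf4Dagger`). [cite: CalderbankEtAl1998, §5 Thm. 13 (printed p. 19: "self-orthogonal if and only if g(x)g†(x) ≡ 0 (mod xⁿ − κ)")] -/
theorem CRSS1998_theorem13 (g : SympVec n) :
    IsSelfOrthogonal (linCyclicCode g) ↔ gf4CycMul g (gf4Dagger g) = 0 := by
  rw [linCyclicCode, isSelfOrthogonal_span_range_iff]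
  constructor
  · intro h
    refine Prod.ext (funext fun m => ?_) (funext fun m => ?_)
    · have := h (Sum.inr 0) (Sum.inl m)
      rw [sympInner_linCycGen] at this
      simpa using this
    · have := h (Sum.inl 0) (Sum.inr m)
      rw [sympInner_linCycGen] at this
      simpa using this
  · intro h x y
    have h1 : ∀ m, (gf4CycMul g (gf4Dagger g)).1 m = 0 := fun m => by rw [h]; rfl
    have h2 : ∀ m, (gf4CycMul g (gf4Dagger g)).2 m = 0 := fun m => by rw [h]; rfl
    -- the sum of the two components is the `(g, x^m g)` inner product
    have h12 : ∀ m, (cycMul g.1 (cycRev g.2) + cycMul g.2 (cycRev g.1)) m = 0 := fun m => by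
      have e : (cycMul g.1 (cycRev g.2) + cycMul g.2 (cycRev g.1)) m =
          (gf4CycMul g (gf4Dagger g)).1 m + (gf4CycMul g (gf4Dagger g)).2 m := by
        simp only [gf4CycMul, gf4Dagger, Pi.add_apply]
        have hx : ∀ x : ZMod 2, x + x = 0 := by decide
        linear_combination -(hx (cycMul g.1 (cycRev g.1) m)) - (hx (cycMul g.2 (cycRev g.2) m))
      rw [e, h1, h2, add_zero]
    rw [sympInner_linCycGen]
    rcases x with s | s <;> rcases y with t | t
    · exact h12 _
    · exact h2 _
    · exact h1 _
    · exact h12 _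

end Literature.InformationTheory.QuantumCodes
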